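import Summits.AtomisticToContinuum.HydrodynamicLimit.Theorems.ImplosionDichotomyPolynomialCompressionUniqueness
import Summits.AtomisticToContinuum.HydrodynamicLimit.Theorems.PolynomialCompression.Negative.Budget
import Summits.AtomisticToContinuum.HydrodynamicLimit.Theorems.DenseExcursion.Negative.Untied
import Summits.AtomisticToContinuum.HydrodynamicLimit.Theorems.ImplosionDichotomyHsEosLowDensity

/-!
# Uniform profiles never witness `PolynomialCompression`: a first-exit bootstrap + uniqueness in the dilute class

Negative knowledge for the crux `ImplosionDichotomy.PolynomialCompression` (stmt-AtomisticToContinuum-12587), from the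
standing disprover's `Cruxes/PolynomialCompression/Disproof.lean` §12 (cycle 4). The crux is `∃ κ > 0, ∃ profiles,
PolynomialCompressionWith κ a₀ θ₀ u₀` (`polynomialCompression_iff_with`, definitional). For UNIFORM profiles
(`a₀ ≡ c`, `θ₀ ≡ ϑ`, `u₀ ≡ v`) the body is FALSE at every `κ > 0` (`polynomialCompressionWith_const_false`, under the
unbundled `HsEosLowDensity` data — a theorem of the tree): admissible data are pinned (`Negative/PdeForm.lean`) to
`(rhoLim, v, ϑ)` with `rhoLim ≡ 1` for a constant activity (`rhoLim_const_eq_one`: the cluster series is a function of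
`β ≡ 1` and has unit mass), the uniform state `(1, v, ϑ)` is a classical solution for every `σ`
(`DenseExcursionUntied.isHardSphereEulerSolution_const`), and EVERY classical solution with these data coincides with it
on its whole interval of existence — so its density is `≡ 1 < σ^(-κ)`. The last step is NOT just the lead's uniqueness
theorem `hsEuler_unique_of_analytic_eos` (which needs BOTH solutions dilute): a hypothetical second solution could a priori
leave the dilute class, where the typed pressure is `deriv`-junk. It is closed by a FIRST-EXIT BOOTSTRAP
(`spaceTime_bootstrap`: continuous induction on `[0,T)` for a field with continuous space–time lift — tube lemma over
the compact torus, `sInf` of the bad times), the same continuity argument every line's a-priori estimate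
(`stub_logBudgetShadowing`) has to run; it is stated here in reusable form, together with its first corollary
`unique_of_dilute` (a classical solution that stays at packing `≤ η₁/2` is unique in the WHOLE typed class — the second
solution is not assumed dilute — so a-priori bounds proved for ONE dilute solution transfer to all). Upshot for the crux: the `∃`-profile
quantifier is load-bearing in a non-degenerate way, and the typed solution class has NO junk member for uniform
data at small `σ`. refuter-cdisprove-stmt-AtomisticToContinuum-12587-g4-0.
-/

noncomputable section

namespace Summit.AtomisticToContinuum.HydrodynamicLimit.Theorems

open MeasureTheory Filter Set Topology
open Literature.MathematicalPhysics.KineticTheory Literature.Analysis.FluidPDE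
open Literature.Analysis.FunctionSpaces

/-- The body of the crux `PolynomialCompression` FOR GIVEN exponent `κ` and profiles `(a₀, θ₀, u₀)` (verbatim). -/
def PolynomialCompressionWith (κ : ℝ) (a₀ θ₀ : Literature.MathematicalPhysics.KineticTheory.T3 → ℝ) (u₀ : Literature.MathematicalPhysics.KineticTheory.T3 → Literature.MathematicalPhysics.KineticTheory.V3) : Prop :=
  ∀ σ₀ : ℝ, 0 < σ₀ → ∃ σ : ℝ, 0 < σ ∧ σ < σ₀ ∧ ∃ (T : ℝ) (ρ θ : ℝ → Literature.MathematicalPhysics.KineticTheory.T3 → ℝ) (u : ℝ → Literature.MathematicalPhysics.KineticTheory.T3 → Literature.MathematicalPhysics.KineticTheory.V3), Literature.MathematicalPhysics.KineticTheory.IsHardSphereEulerSolution σ T ρ u θ ∧ (∀ Φ : (N : ℕ) → Literature.Analysis.FluidPDE.HardSphereFlow (Literature.Analysis.FluidPDE.Torus.geometry (Fin 3)) (Literature.MathematicalPhysics.KineticTheory.hsDiameter σ N) (N + 1), Literature.MathematicalPhysics.KineticTheory.TendstoHydroFieldsAt (fun N => Literature.MathematicalPhysics.KineticTheory.localGibbsLaw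 σ a₀ u₀ θ₀ N (Φ N)) Φ ρ u θ 0) ∧ ∃ t ∈ Set.Ico 0 T, ∃ x, σ ^ (-κ) ≤ ρ t x

/-- The crux is `∃ κ > 0, ∃ continuous positive profiles, PolynomialCompressionWith κ a₀ θ₀ u₀` (definitional). -/
theorem polynomialCompression_iff_with :
    Summit.AtomisticToContinuum.HydrodynamicLimit.Theses.ImplosionDichotomy.PolynomialCompression ↔
      ∃ κ : ℝ, 0 < κ ∧ ∃ (a₀ θ₀ : T3 → ℝ) (u₀ : T3 → V3), Continuous a₀ ∧ Continuous θ₀ ∧ Continuous u₀ ∧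
        (∀ x, 0 < a₀ x) ∧ (∀ x, 0 < θ₀ x) ∧ PolynomialCompressionWith κ a₀ θ₀ u₀ :=
  Iff.rfl

namespace PolynomialCompressionConstantProfiles

open PolynomialCompressionPDE (Flows admissible_iff_data continuous_slices_zero)
open PolynomialCompressionStatics (integral_rhoLim_eq_one)

/-! ### Continuous induction on `[0,T)` for space–time fields -/

/-- **FIRST-EXIT BOOTSTRAP on `[0,T) × 𝕋³`.** Let `f` have a continuous space–time lift on `[0,T) × ℝ³`, `a < b`,
`f(0,·) ≤ a`, and suppose that for every `0 < t ≤ T` the WEAK bound `f ≤ b` on `[0,t) × 𝕋³` implies the STRONG bound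
`f ≤ a` there. Then `f ≤ a` on all of `[0,T) × 𝕋³` (the infimum `τ` of the bad times has `f(τ,·) ≤ a` by continuity
from the left, hence `f < b` slightly beyond `τ` uniformly on the compact torus — tube lemma — and the step
hypothesis pushes the strong bound past `τ`). [folklore] -/
theorem spaceTime_bootstrap {T a b : ℝ} {f : ℝ → T3 → ℝ}
    (hf : ContinuousOn (Torus.stLift f) (Ico 0 T ×ˢ univ)) (hab : a < b) (h0 : 0 < T → ∀ x, f 0 x ≤ a)
    (hstep : ∀ t : ℝ, 0 < t → t ≤ T → (∀ s ∈ Ico 0 t, ∀ x, f s x ≤ b) → ∀ s ∈ Ico 0 t, ∀ x, f s x ≤ a) :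
    ∀ t ∈ Ico 0 T, ∀ x, f t x ≤ a := by
  by_contra hcon
  push Not at hcon
  set Bad : Set ℝ := {t | t ∈ Ico 0 T ∧ ∃ x, a < f t x} with hBad
  have hne : Bad.Nonempty := by
    obtain ⟨t, ht, x, hx⟩ := hcon
    exact ⟨t, ht, x, hx⟩
  have hbdd : BddBelow Bad := ⟨0, fun t ht => ht.1.1⟩
  set τ : ℝ := sInf Bad with hτ
  have hτ0 : 0 ≤ τ := le_csInf hne fun t ht => ht.1.1
  obtain ⟨t₁, ht₁⟩ := hne
  have hτT : τ < T := (csInf_le hbdd ht₁).trans_lt ht₁.1.2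
  have hT : 0 < T := hτ0.trans_lt hτT
  have hτmem : τ ∈ Ico 0 T := ⟨hτ0, hτT⟩
  -- before `τ` the strong bound holds
  have hgood : ∀ s ∈ Ico 0 τ, ∀ x, f s x ≤ a := by
    intro s hs x
    by_contra hsx
    push Not at hsx
    have hsBad : s ∈ Bad := ⟨⟨hs.1, hs.2.trans hτT⟩, x, hsx⟩
    exact (not_le.2 hs.2) (csInf_le hbdd hsBad)
  -- slices are continuous within `[0,T)`
  have hslice : ∀ x, ContinuousWithinAt (fun s => f s x) (Ico 0 T) τ := by
    intro x
    have hcomp : ContinuousOn (fun s : ℝ => Torus.stLift f (s, Torus.repr x)) (Ico 0 T) :=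
      hf.comp (continuousOn_id.prodMk continuousOn_const) fun s hs => mk_mem_prod hs (mem_univ _)
    have hfun : (fun s : ℝ => Torus.stLift f (s, Torus.repr x)) = fun s => f s x := by
      funext s
      simp [Torus.stLift_apply, Torus.proj_repr]
    rw [hfun] at hcomp
    exact hcomp τ hτmem
  -- at `τ` itself the strong bound holds
  have hτa : ∀ x, f τ x ≤ a := by
    intro x
    rcases hτ0.eq_or_lt with h | h
    · rw [← h]; exact h0 hT x
    · have hsub : Ico 0 τ ⊆ Ico 0 T := Ico_subset_Ico_right hτT.le
      have htend : Tendsto (fun s => f s x) (𝓝[Ico 0 τ] τ) (𝓝 (f τ x)) := (hslice x).mono hsub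
      haveI : (𝓝[Ico 0 τ] τ).NeBot := by
        refine mem_closure_iff_nhdsWithin_neBot.1 ?_
        rw [closure_Ico h.ne]
        exact right_mem_Icc.2 h.le
      exact le_of_tendsto htend (eventually_mem_nhdsWithin.mono fun s hs => hgood s hs x)
  -- tube lemma: `f < b` uniformly shortly after `τ`
  have htube := Torus.eventually_norm_sub_lt_of_continuousOn hf hτmem (sub_pos.2 hab)
  obtain ⟨δ, hδ, hδf⟩ := Metric.eventually_nhds_iff.1 (eventually_nhdsWithin_iff.1 htube)
  set t₂ : ℝ := τ + min (δ / 2) ((T - τ) / 2) with ht₂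
  have hmin : 0 < min (δ / 2) ((T - τ) / 2) := lt_min (by positivity) (by linarith)
  have ht₂τ : τ < t₂ := by rw [ht₂]; linarith
  have ht₂T : t₂ ≤ T := by
    have : min (δ / 2) ((T - τ) / 2) ≤ (T - τ) / 2 := min_le_right _ _
    rw [ht₂]; linarith
  have ht₂0 : 0 < t₂ := hτ0.trans_lt ht₂τ
  have hweak : ∀ s ∈ Ico 0 t₂, ∀ x, f s x ≤ b := by
    intro s hs x
    rcases lt_or_ge s τ with hsτ | hsτ
    · exact (hgood s ⟨hs.1, hsτ⟩ x).trans hab.le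
    · have hsT : s ∈ Ico 0 T := ⟨hs.1, hs.2.trans_le ht₂T⟩
      have hdist : dist s τ < δ := by
        rw [Real.dist_eq, abs_of_nonneg (sub_nonneg.2 hsτ)]
        have : min (δ / 2) ((T - τ) / 2) ≤ δ / 2 := min_le_left _ _
        have hs2 := hs.2
        rw [ht₂] at hs2
        linarith
      have h1 : ‖f s x - f τ x‖ < b - a := hδf hdist hsT x
      have h2 : f s x - f τ x < b - a := (le_abs_self _).trans_lt (Real.norm_eq_abs _ ▸ h1)
      linarith [hτa x]
  have hstrong := hstep t₂ ht₂0 ht₂T hweak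
  -- but there is a bad time in `[τ, t₂)`
  obtain ⟨t, htBad, htlt⟩ := exists_lt_of_csInf_lt ⟨t₁, ht₁⟩ ht₂τ
  obtain ⟨x, hx⟩ := htBad.2
  have := hstrong t ⟨htBad.1.1, htlt⟩ x
  linarith

/-! ### Uniform data stay uniform -/

/-- For a CONSTANT activity the pinned density is `≡ 1`: the cluster series `rhoLim` is a function of `β = a₀/∫a₀ ≡ 1`,
hence constant on `𝕋³`, and it has unit mass. [folklore] -/
theorem rhoLim_const_eq_one {c : ℝ} (hc : 0 < c) {σ : ℝ}
    (h : SmallDensity (profileOf (fun _ : T3 => c) continuous_const fun _ => hc) σ) (x : T3) :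
    rhoLim (profileOf (fun _ : T3 => c) continuous_const fun _ => hc) σ x = 1 := by
  set P := profileOf (fun _ : T3 => c) continuous_const (fun _ => hc) with hP
  have hβ : ∀ y, P.β y = 1 := fun y => by
    rw [hP, profileOf_β, integral_const, smul_eq_mul, probReal_univ, one_mul, div_self hc.ne']
  have hind : ∀ y, rhoLim P σ y = rhoLim P σ x := fun y => by
    unfold rhoLim; simp_rw [hβ]
  have hint := integral_rhoLim_eq_one h
  have hfun : (fun y => rhoLim P σ y) = fun _ => rhoLim P σ x := funext hind
  rw [hfun, integral_const, smul_eq_mul, probReal_univ, one_mul] at hint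
  exact hint

/-- **UNIFORM PROFILES NEVER WITNESS THE CRUX.** Under the `HsEosLowDensity` data `(η₀, F)`: for every `κ > 0`,
constant activity `c > 0`, temperature `ϑ > 0` and velocity `v`, `PolynomialCompressionWith κ (c, ϑ, v)` is false —
every admissible classical solution with uniform data IS the uniform state `(1, v, ϑ)` on its whole interval of
existence (data pinning + uniqueness in the dilute class + the first-exit bootstrap), so its density never exceeds
`1 < σ^(-κ)`. [folklore] -/
theorem polynomialCompressionWith_const_false {η₀ : ℝ} {F : ℝ → ℝ} (hη₀ : 0 < η₀)
    (hF : AnalyticOnNhd ℝ F (Ioo (-η₀) η₀)) (hEq : EqOn hsExcessFreeEnergy F (Ico 0 η₀))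
    {κ c ϑ : ℝ} (hκ : 0 < κ) (hc : 0 < c) (hϑ : 0 < ϑ) (v : V3) :
    ¬ PolynomialCompressionWith κ (fun _ => c) (fun _ => ϑ) (fun _ => v) := by
  intro H
  obtain ⟨η₁, hη₁, U⟩ := hsEuler_unique_of_analytic_eos η₀ hη₀ F hF hEq
  obtain ⟨σ₁, hσ₁, -, G⟩ := admissible_iff_data (a₀ := fun _ : T3 => c) (θ₀ := fun _ => ϑ) (u₀ := fun _ => v)
    continuous_const continuous_const continuous_const (fun _ => hc) (fun _ => hϑ)
  obtain ⟨σ, hσ, hσlt, T, ρ, θ, u, hE, hA, t, ht, x, hx⟩ :=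
    H (min σ₁ (min 1 (η₁ / 2))) (lt_min hσ₁ (lt_min one_pos (by positivity)))
  have hσ₁' : σ < σ₁ := lt_of_lt_of_le hσlt (min_le_left _ _)
  have hσ1 : σ < 1 := lt_of_lt_of_le hσlt ((min_le_right _ _).trans (min_le_left _ _))
  have hση : σ < η₁ / 2 := lt_of_lt_of_le hσlt ((min_le_right _ _).trans (min_le_right _ _))
  have hT : 0 < T := ht.1.trans_lt ht.2
  have hσ3 : σ ^ 3 ≤ σ := pow_le_of_le_one hσ.le hσ1.le three_ne_zero
  have hσ3η : σ ^ 3 < η₁ := by linarith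
  -- data pinning: `(ρ, u, θ)(0) = (1, v, ϑ)`
  obtain ⟨hS, G'⟩ := G σ hσ hσ₁'
  obtain ⟨hρc, huc, hθc⟩ := continuous_slices_zero hE hT
  obtain ⟨hρ0, hu0, hθ0⟩ := (G' ρ θ u hρc huc hθc).1 hA
  have hρ0' : ρ 0 = fun _ => 1 := by
    rw [hρ0]; funext y; exact rhoLim_const_eq_one hc hS y
  -- bootstrap on the packing: weak bound `≤ η₁`, strong bound `≤ σ³`
  have hP : Torus.IsSmoothSpaceTimeOn (Ico 0 T) (fun s y => ρ s y * σ ^ 3) :=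
    hE.smooth_density.mul (contDiffOn_const (c := σ ^ 3))
  have hf : ContinuousOn (Torus.stLift (fun s y => ρ s y * σ ^ 3)) (Ico 0 T ×ˢ univ) := hP.continuousOn_stLift
  have key : ∀ s ∈ Ico 0 T, ∀ y, ρ s y * σ ^ 3 ≤ σ ^ 3 := by
    refine spaceTime_bootstrap hf hσ3η (fun _ y => ?_) fun t' ht'0 ht'T hweak s hs y => ?_
    · rw [hρ0']; simp
    · have hEt := isHardSphereEulerSolution_restrict hE ht'T
      have hC := DenseExcursionUntied.isHardSphereEulerSolution_const σ t' v one_pos hϑ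
      have hpk' : ∀ s ∈ Ico 0 t', ∀ (y : T3), (fun (_ : ℝ) (_ : T3) => (1 : ℝ)) s y * σ ^ 3 ≤ η₁ :=
        fun s _ y => by simpa using hσ3η.le
      obtain ⟨hρs, -, -⟩ := U σ hσ t' ρ θ u (fun _ _ => 1) (fun _ _ => ϑ) (fun _ _ => v) hEt hC hweak hpk'
        hρ0' hu0 hθ0 s hs
      have : ρ s y = 1 := congrFun hρs y
      rw [this, one_mul]
  -- contradiction at the compression point
  have h1 : ρ t x ≤ 1 := by
    have := key t ht x
    have hs3 : 0 < σ ^ 3 := pow_pos hσ 3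
    nlinarith
  have h2 : 1 < σ ^ (-κ) := Real.one_lt_rpow_of_pos_of_lt_one_of_neg hσ hσ1 (neg_neg_of_pos hκ)
  linarith

/-- **DILUTE CLASSICAL SOLUTIONS ARE UNIQUE IN THE WHOLE TYPED CLASS.** Under the `HsEosLowDensity` data `(η₀, F)` there
is `η₁ > 0` such that for every `σ > 0`: if a classical solution `(ρ, u, θ)` on `[0,T)` keeps packing `≤ η₁/2`, then EVERY
classical solution `(ρ', u', θ')` on `[0,T')` with the same data coincides with it on `[0, min T T')` — the second solution is
not assumed dilute (first-exit bootstrap on its packing + the lead's uniqueness theorem in the dilute class). For the line: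
a-priori bounds proved for ONE dilute solution with the pinned data transfer to all solutions with these data. [folklore] -/
theorem unique_of_dilute {η₀ : ℝ} {F : ℝ → ℝ} (hη₀ : 0 < η₀)
    (hF : AnalyticOnNhd ℝ F (Ioo (-η₀) η₀)) (hEq : EqOn hsExcessFreeEnergy F (Ico 0 η₀)) :
    ∃ η₁ : ℝ, 0 < η₁ ∧ ∀ σ : ℝ, 0 < σ →
      ∀ (T T' : ℝ) (ρ θ : ℝ → T3 → ℝ) (u : ℝ → T3 → V3) (ρ' θ' : ℝ → T3 → ℝ) (u' : ℝ → T3 → V3),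
        IsHardSphereEulerSolution σ T ρ u θ → IsHardSphereEulerSolution σ T' ρ' u' θ' →
        (∀ t ∈ Ico 0 T, ∀ x, ρ t x * σ ^ 3 ≤ η₁ / 2) → ρ 0 = ρ' 0 → u 0 = u' 0 → θ 0 = θ' 0 →
          ∀ t ∈ Ico 0 (min T T'), ρ' t = ρ t ∧ u' t = u t ∧ θ' t = θ t := by
  obtain ⟨η₁, hη₁, U⟩ := hsEuler_unique_of_analytic_eos η₀ hη₀ F hF hEq
  refine ⟨η₁, hη₁, fun σ hσ T T' ρ θ u ρ' θ' u' hE hE' hpk h0 hu0 hθ0 => ?_⟩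
  set S : ℝ := min T T' with hS
  have hES : IsHardSphereEulerSolution σ S ρ u θ := isHardSphereEulerSolution_restrict hE (min_le_left _ _)
  have hES' : IsHardSphereEulerSolution σ S ρ' u' θ' := isHardSphereEulerSolution_restrict hE' (min_le_right _ _)
  -- uniqueness on `[0,t)` as soon as the second solution is dilute there
  have huniq : ∀ t : ℝ, t ≤ S → (∀ s ∈ Ico 0 t, ∀ x, ρ' s x * σ ^ 3 ≤ η₁) →
      ∀ s ∈ Ico 0 t, ρ' s = ρ s ∧ u' s = u s ∧ θ' s = θ s := by
    intro t htS hweak s hs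
    have hEt := isHardSphereEulerSolution_restrict hES htS
    have hEt' := isHardSphereEulerSolution_restrict hES' htS
    have hpkt : ∀ s ∈ Ico 0 t, ∀ x, ρ s x * σ ^ 3 ≤ η₁ := fun s hs x =>
      (hpk s ⟨hs.1, hs.2.trans_le (htS.trans (min_le_left _ _))⟩ x).trans (by linarith)
    obtain ⟨h1, h2, h3⟩ := U σ hσ t ρ' θ' u' ρ θ u hEt' hEt hweak hpkt h0.symm hu0.symm hθ0.symm s hs
    exact ⟨h1, h2, h3⟩
  -- bootstrap on the packing of the second solution: weak `≤ η₁`, strong `≤ η₁/2`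
  have hP : Torus.IsSmoothSpaceTimeOn (Ico 0 S) (fun s y => ρ' s y * σ ^ 3) :=
    hES'.smooth_density.mul (contDiffOn_const (c := σ ^ 3))
  have key : ∀ s ∈ Ico 0 S, ∀ y, ρ' s y * σ ^ 3 ≤ η₁ / 2 := by
    refine spaceTime_bootstrap hP.continuousOn_stLift (by linarith : η₁ / 2 < η₁) (fun hS0 y => ?_)
      fun t ht0 htS hweak s hs y => ?_
    · rw [← h0]; exact hpk 0 ⟨le_rfl, hS0.trans_le (min_le_left _ _)⟩ y
    · obtain ⟨h1, -, -⟩ := huniq t htS hweak s hs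
      rw [congrFun h1 y]
      exact hpk s ⟨hs.1, hs.2.trans_le (htS.trans (min_le_left _ _))⟩ y
  intro t ht
  exact huniq S le_rfl (fun s hs x => (key s hs x).trans (by linarith)) t ht

/-- `unique_of_dilute` with NO hypothesis left (stmt-0768 is a theorem): some `η₁ > 0` works for every `σ > 0`. [folklore] -/
theorem unique_of_dilute_eos :
    ∃ η₁ : ℝ, 0 < η₁ ∧ ∀ σ : ℝ, 0 < σ →
      ∀ (T T' : ℝ) (ρ θ : ℝ → T3 → ℝ) (u : ℝ → T3 → V3) (ρ' θ' : ℝ → T3 → ℝ) (u' : ℝ → T3 → V3),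
        IsHardSphereEulerSolution σ T ρ u θ → IsHardSphereEulerSolution σ T' ρ' u' θ' →
        (∀ t ∈ Ico 0 T, ∀ x, ρ t x * σ ^ 3 ≤ η₁ / 2) → ρ 0 = ρ' 0 → u 0 = u' 0 → θ 0 = θ' 0 →
          ∀ t ∈ Ico 0 (min T T'), ρ' t = ρ t ∧ u' t = u t ∧ θ' t = θ t := by
  obtain ⟨η₀, hη₀, F, hF, hEq, -, -, -⟩ := hsEosLowDensity_proof
  exact unique_of_dilute hη₀ hF hEq

/-- **UNIFORM PROFILES NEVER WITNESS THE CRUX — unconditionally** (the equation of state `HsEosLowDensity`, stmt-0768, is a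
theorem of the tree: `hsEosLowDensity_proof`): for every `κ > 0`, `c, ϑ > 0` and `v`,
`¬ PolynomialCompressionWith κ (c, ϑ, v)`. [folklore] -/
theorem polynomialCompressionWith_const_false_eos {κ c ϑ : ℝ} (hκ : 0 < κ) (hc : 0 < c) (hϑ : 0 < ϑ) (v : V3) :
    ¬ PolynomialCompressionWith κ (fun _ => c) (fun _ => ϑ) (fun _ => v) := by
  obtain ⟨η₀, hη₀, F, hF, hEq, -, -, -⟩ := hsEosLowDensity_proof
  exact polynomialCompressionWith_const_false hη₀ hF hEq hκ hc hϑ v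

end PolynomialCompressionConstantProfiles

end Summit.AtomisticToContinuum.HydrodynamicLimit.Theorems

end
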